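import Summits.Parity.GeneralizedHardyLittlewood.Theorems.BeyondDiagonalBeatsQuarter.OffDiagHeartCoreSplitLU
import Mathlib.Analysis.SpecialFunctions.Pow.Asymptotics
import HarnessLib

/-!
# Route `PrimeLevelFamEdge`, crux K_B (stmt-Parity-20343), line `diagonal_kernel_split` rev 4, plan Ω,
# L7d leaf **D7a — `OffDiagLargeConductorScales`: block currency and «power saving ⇒ funded»** (L7D-PLAN §3 D7,
# the D5b-independent half)

The funded slots of `offDiagBelowSlack_io_of_coreSplit₃` (p652193) ask, for a piece `Q Δ′ N`, that
`∀ Δ′ ∈ (1,2) ∀ ε > 0 ∃ N₀ ∀ N ≥ N₀: Q Δ′ N ≤ ε·Σ_{q ∈ goodPrimes Δ′ N} ms`. The keystone of L7d pt 2 (D5b, prover-6) will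
deliver `FL` in LEDGER currency: `(explicit)·(log N)^C·N^{−σ}·Σ ms` with the saving exponent `σ > 0` of the window
(`l7Window_nonempty`: `δ = 3η`, `ε₀ = ε = η/16`). This file is the currency exchange:

* `exists_log_pow_mul_rpow_neg_le` — `K·(log N)^C·N^{−σ} ≤ ε` for all large `N` (`σ > 0`; Mathlib
  `isLittleO_log_rpow_rpow_atTop`);
* block facts for a level `q ∈ goodPrimes Δ′ N`: `cast_lt_and_le_of_mem_goodPrimes` (`N < q ≤ 2N`), `rpow_level_le`,
  `rpow_neg_level_le`, `log_level_le`, and **`sum_rpow_mul_log_pow_mul_mainScaleReal_le`**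
  (`Σ_{q∈G} q^a (log q)^C ms(q) ≤ (2N)^a (log 2N)^C Σ_{q∈G} ms(q)`, `a ≥ 0`);
* **`funded_of_rpow_log_saving`** — a piece eventually `≤ K·(log N)^C·N^{−σ}·Σms` (`σ > 0`) fills a funded slot VERBATIM;
* `l7_saving_exponent`, `l7_modulus_room` — the window arithmetic: `δ/2 − ((5/4)η + 2ε₀ + ε) = η/16 > 0` and
  `δ < 1/2 − η − 3ε` at `δ = 3η`, `ε₀ = ε = η/16`, `0 < η < 1/10`.

D7b (the instantiation on D5b's displayed bound) follows when `OffDiagLargeConductorCells` is stated. Helper; closes nothing;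
no definitions; standard axioms. «The programme SEARCHES and TYPES; no claim about Landau–Siegel zeros, Theorems 1–2 of
arXiv:2211.02515 or a repaired Margin232 until a kernel theorem says so.»
-/

noncomputable section

open Finset Filter Asymptotics
open scoped Real

namespace Summit.Parity.GeneralizedHardyLittlewood.Theorems.BeyondDiagonalBeatsQuarter.OffDiag

open Literature.NumberTheory.LFunctions Literature.NumberTheory.LFunctions.KMV2000

/-! ### `K (log N)^C N^{−σ} → 0` -/

/-- **Power savings beat logarithms**: for `σ > 0`, any `C : ℕ`, `K : ℝ` and `ε > 0` there is `N₀` with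
`K·(log N)^C·N^{−σ} ≤ ε` for all `N ≥ N₀`. [folklore] -/
theorem exists_log_pow_mul_rpow_neg_le {σ : ℝ} (hσ : 0 < σ) (C : ℕ) (K : ℝ) {ε : ℝ} (hε : 0 < ε) :
    ∃ N₀ : ℕ, ∀ N : ℕ, N₀ ≤ N → K * Real.log N ^ C * (N : ℝ) ^ (-σ) ≤ ε := by
  -- `(log x)^C ≤ c·x^σ` eventually, with `c = ε/(|K|+1)`
  have hc : 0 < ε / (|K| + 1) := by positivity
  have hlo := (isLittleO_log_rpow_rpow_atTop (C : ℝ) hσ).bound hc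
  obtain ⟨x₀, hx₀⟩ := Filter.eventually_atTop.mp hlo
  refine ⟨max 1 ⌈x₀⌉₊, fun N hN ↦ ?_⟩
  have hN1 : 1 ≤ N := le_of_max_le_left hN
  have hNx : x₀ ≤ (N : ℝ) := (Nat.le_ceil x₀).trans (by exact_mod_cast le_of_max_le_right hN)
  have hN0 : (0 : ℝ) < N := by exact_mod_cast hN1
  have hlog0 : 0 ≤ Real.log N := Real.log_natCast_nonneg N
  have h1 := hx₀ (N : ℝ) hNx
  rw [Real.norm_of_nonneg (Real.rpow_nonneg hlog0 _), Real.norm_of_nonneg (Real.rpow_nonneg hN0.le _),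
    Real.rpow_natCast] at h1
  -- `K (log N)^C N^{−σ} ≤ |K|·c·x^σ·x^{−σ} = |K| c ≤ ε`
  have hpos : 0 < (N : ℝ) ^ (-σ) := Real.rpow_pos_of_pos hN0 _
  have hprod : (N : ℝ) ^ σ * (N : ℝ) ^ (-σ) = 1 := by
    rw [← Real.rpow_add hN0, add_neg_cancel, Real.rpow_zero]
  calc K * Real.log N ^ C * (N : ℝ) ^ (-σ) ≤ |K| * Real.log N ^ C * (N : ℝ) ^ (-σ) := by
        have : K * Real.log N ^ C ≤ |K| * Real.log N ^ C :=
          mul_le_mul_of_nonneg_right (le_abs_self K) (pow_nonneg hlog0 C)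
        exact mul_le_mul_of_nonneg_right this hpos.le
    _ ≤ |K| * (ε / (|K| + 1) * (N : ℝ) ^ σ) * (N : ℝ) ^ (-σ) :=
        mul_le_mul_of_nonneg_right (mul_le_mul_of_nonneg_left h1 (abs_nonneg K)) hpos.le
    _ = |K| / (|K| + 1) * ε := by
        rw [show |K| * (ε / (|K| + 1) * (N : ℝ) ^ σ) * (N : ℝ) ^ (-σ) =
          |K| / (|K| + 1) * ε * ((N : ℝ) ^ σ * (N : ℝ) ^ (-σ)) by ring, hprod, mul_one]
    _ ≤ 1 * ε := by
        refine mul_le_mul_of_nonneg_right ?_ hε.le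
        rw [div_le_one (by positivity)]
        linarith [abs_nonneg K]
    _ = ε := one_mul ε

/-! ### Block currency for the levels of `goodPrimes Δ′ N` -/

/-- A good prime of the block satisfies `N < q ≤ 2N` (real casts). [folklore] -/
theorem cast_lt_and_le_of_mem_goodPrimes {Δ' : ℝ} {N q : ℕ} (hq : q ∈ goodPrimes Δ' N) :
    (N : ℝ) < q ∧ (q : ℝ) ≤ 2 * N := by
  obtain ⟨h1, h2, -, -⟩ := mem_goodPrimes_iff.mp hq
  exact ⟨by exact_mod_cast h1, by exact_mod_cast h2⟩

/-- `q^a ≤ (2N)^a` for a good prime `q` of the block (`a ≥ 0`). [folklore] -/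
theorem rpow_level_le {Δ' : ℝ} {N q : ℕ} (hq : q ∈ goodPrimes Δ' N) {a : ℝ} (ha : 0 ≤ a) :
    (q : ℝ) ^ a ≤ (2 * N : ℝ) ^ a :=
  Real.rpow_le_rpow (Nat.cast_nonneg q) (cast_lt_and_le_of_mem_goodPrimes hq).2 ha

/-- `q^{−a} ≤ N^{−a}` for a good prime `q` of the block (`a ≥ 0`, `N ≥ 1`). [folklore] -/
theorem rpow_neg_level_le {Δ' : ℝ} {N q : ℕ} (hq : q ∈ goodPrimes Δ' N) (hN : 1 ≤ N) {a : ℝ} (ha : 0 ≤ a) :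
    (q : ℝ) ^ (-a) ≤ (N : ℝ) ^ (-a) := by
  have hN0 : (0 : ℝ) < N := by exact_mod_cast hN
  exact Real.rpow_le_rpow_of_nonpos hN0 (cast_lt_and_le_of_mem_goodPrimes hq).1.le (by linarith)

/-- `log q ≤ log(2N)` for a good prime `q` of the block. [folklore] -/
theorem log_level_le {Δ' : ℝ} {N q : ℕ} (hq : q ∈ goodPrimes Δ' N) : Real.log q ≤ Real.log (2 * N) := by
  obtain ⟨h1, h2⟩ := cast_lt_and_le_of_mem_goodPrimes hq
  have hq0 : (0 : ℝ) < q := lt_of_le_of_lt (Nat.cast_nonneg N) h1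
  exact Real.log_le_log hq0 h2

/-- **Ledger monomials leave the block sum**: for `a ≥ 0` and any `C`,
`Σ_{q∈goodPrimes Δ′ N} q^a (log q)^C ms(q) ≤ (2N)^a (log 2N)^C · Σ_{q∈goodPrimes Δ′ N} ms(q)` (`N ≥ 1`). [folklore] -/
theorem sum_rpow_mul_log_pow_mul_mainScaleReal_le {Δ' : ℝ} {N : ℕ} (hN : 1 ≤ N) {a : ℝ} (ha : 0 ≤ a) (C : ℕ) :
    ∑ q ∈ goodPrimes Δ' N, (q : ℝ) ^ a * Real.log q ^ C * mainScaleReal Δ' q ≤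
      (2 * N : ℝ) ^ a * Real.log (2 * N) ^ C * ∑ q ∈ goodPrimes Δ' N, mainScaleReal Δ' q := by
  rw [Finset.mul_sum]
  refine Finset.sum_le_sum fun q hq ↦ ?_
  obtain ⟨h1, -⟩ := cast_lt_and_le_of_mem_goodPrimes hq
  have hq1 : (1 : ℝ) ≤ q := by
    have : (1 : ℝ) ≤ N := by exact_mod_cast hN
    linarith
  have hlog0 : 0 ≤ Real.log q := Real.log_nonneg hq1
  refine mul_le_mul_of_nonneg_right ?_ (mainScaleReal_nonneg Δ' q)
  exact mul_le_mul (rpow_level_le hq ha) (pow_le_pow_left₀ hlog0 (log_level_le hq) C)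
    (pow_nonneg hlog0 C) (Real.rpow_nonneg (by positivity) a)

/-! ### Power saving ⇒ funded -/

/-- **A power saving in ledger currency fills a funded slot.** If for every `Δ′ ∈ (1,2)` there are `σ > 0`, `C`, `K`, `N₁`
with `Q Δ′ N ≤ K·(log N)^C·N^{−σ}·Σ_{q∈goodPrimes Δ′ N} ms` for all `N ≥ N₁`, then
`∀ Δ′ ∈ (1,2) ∀ ε > 0 ∃ N₀ ∀ N ≥ N₀: Q Δ′ N ≤ ε·Σ_{q∈goodPrimes Δ′ N} ms` — the funded slot of
`offDiagBelowSlack_io_of_coreSplit₃` VERBATIM. [folklore] -/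
theorem funded_of_rpow_log_saving (Q : ℝ → ℕ → ℝ)
    (hQ : ∀ Δ' : ℝ, 1 < Δ' → Δ' < 2 → ∃ σ : ℝ, 0 < σ ∧ ∃ C : ℕ, ∃ K : ℝ, ∃ N₁ : ℕ, ∀ N : ℕ, N₁ ≤ N →
      Q Δ' N ≤ K * Real.log N ^ C * (N : ℝ) ^ (-σ) * ∑ q ∈ goodPrimes Δ' N, mainScaleReal Δ' q) :
    ∀ Δ' : ℝ, 1 < Δ' → Δ' < 2 → ∀ ε : ℝ, 0 < ε → ∃ N₀ : ℕ, ∀ N : ℕ, N₀ ≤ N →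
      Q Δ' N ≤ ε * ∑ q ∈ goodPrimes Δ' N, mainScaleReal Δ' q := by
  intro Δ' h1 h2 ε hε
  obtain ⟨σ, hσ, C, K, N₁, hN₁⟩ := hQ Δ' h1 h2
  obtain ⟨N₂, hN₂⟩ := exists_log_pow_mul_rpow_neg_le hσ C K hε
  refine ⟨max N₁ N₂, fun N hN ↦ ?_⟩
  have ha := hN₁ N (le_trans (le_max_left _ _) hN)
  have hb := hN₂ N (le_trans (le_max_right _ _) hN)
  exact ha.trans (mul_le_mul_of_nonneg_right hb (Finset.sum_nonneg fun q _ ↦ mainScaleReal_nonneg Δ' q))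

/-- The same with an extra ledger monomial `q^a (log q)^C` INSIDE the block sum (the K2 shape
`|offDiagCore| ≤ q^{(5/4)(Δ′−1)+2ε₀+ε}·ms`): if `Q Δ′ N ≤ K·N^{−τ}·Σ_q q^a (log q)^C ms(q)` eventually with `0 ≤ a < τ`,
the slot is funded (saving `σ = τ − a`, using `sum_rpow_mul_log_pow_mul_mainScaleReal_le`). [folklore] -/
theorem funded_of_rpow_saving_ledger (Q : ℝ → ℕ → ℝ)
    (hQ : ∀ Δ' : ℝ, 1 < Δ' → Δ' < 2 → ∃ a τ : ℝ, 0 ≤ a ∧ a < τ ∧ ∃ C : ℕ, ∃ K : ℝ, 0 ≤ K ∧ ∃ N₁ : ℕ, ∀ N : ℕ, N₁ ≤ N →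
      Q Δ' N ≤ K * (N : ℝ) ^ (-τ) * ∑ q ∈ goodPrimes Δ' N, (q : ℝ) ^ a * Real.log q ^ C * mainScaleReal Δ' q) :
    ∀ Δ' : ℝ, 1 < Δ' → Δ' < 2 → ∀ ε : ℝ, 0 < ε → ∃ N₀ : ℕ, ∀ N : ℕ, N₀ ≤ N →
      Q Δ' N ≤ ε * ∑ q ∈ goodPrimes Δ' N, mainScaleReal Δ' q := by
  refine funded_of_rpow_log_saving Q fun Δ' h1 h2 ↦ ?_
  obtain ⟨a, τ, ha, haτ, C, K, hK, N₁, hN₁⟩ := hQ Δ' h1 h2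
  refine ⟨τ - a, by linarith, C, K * (2 : ℝ) ^ a * (2 : ℝ) ^ C, max 2 N₁, fun N hN ↦ ?_⟩
  have hN2 : 2 ≤ N := le_of_max_le_left hN
  have hN1 : 1 ≤ N := le_trans (by norm_num) hN2
  have hN0 : (0 : ℝ) < N := by exact_mod_cast (lt_of_lt_of_le zero_lt_one hN1)
  have h := hN₁ N (le_of_max_le_right hN)
  have hS0 : 0 ≤ ∑ q ∈ goodPrimes Δ' N, mainScaleReal Δ' q :=
    Finset.sum_nonneg fun q _ ↦ mainScaleReal_nonneg Δ' q
  have hblock := sum_rpow_mul_log_pow_mul_mainScaleReal_le (Δ' := Δ') hN1 ha C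
  -- `(2N)^a = 2^a N^a`, `log(2N) ≤ 2 log N` for `N ≥ 2`, and `N^{−τ} N^{a} = N^{−(τ−a)}`
  have h2N : (2 * N : ℝ) ^ a = (2 : ℝ) ^ a * (N : ℝ) ^ a := Real.mul_rpow (by norm_num) hN0.le
  have hlogN : 0 ≤ Real.log N := Real.log_natCast_nonneg N
  have hlog2N : Real.log (2 * N) ≤ 2 * Real.log N := by
    rw [Real.log_mul (by norm_num) hN0.ne', two_mul]
    have : Real.log 2 ≤ Real.log N := Real.log_le_log (by norm_num) (by exact_mod_cast hN2)
    linarith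
  have hlog2N0 : 0 ≤ Real.log (2 * N) := Real.log_nonneg (by
    have : (2 : ℝ) ≤ N := by exact_mod_cast hN2
    linarith)
  have hlogpow : Real.log (2 * N) ^ C ≤ (2 : ℝ) ^ C * Real.log N ^ C := by
    rw [← mul_pow]; exact pow_le_pow_left₀ hlog2N0 hlog2N C
  have hexp : (N : ℝ) ^ (-τ) * (N : ℝ) ^ a = (N : ℝ) ^ (-(τ - a)) := by
    rw [← Real.rpow_add hN0]; ring_nf
  calc Q Δ' N ≤ K * (N : ℝ) ^ (-τ) * ∑ q ∈ goodPrimes Δ' N, (q : ℝ) ^ a * Real.log q ^ C * mainScaleReal Δ' q := h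
    _ ≤ K * (N : ℝ) ^ (-τ) * ((2 * N : ℝ) ^ a * Real.log (2 * N) ^ C * ∑ q ∈ goodPrimes Δ' N, mainScaleReal Δ' q) :=
        mul_le_mul_of_nonneg_left hblock (mul_nonneg hK (Real.rpow_nonneg hN0.le _))
    _ ≤ K * (N : ℝ) ^ (-τ) * ((2 : ℝ) ^ a * (N : ℝ) ^ a * ((2 : ℝ) ^ C * Real.log N ^ C) *
          ∑ q ∈ goodPrimes Δ' N, mainScaleReal Δ' q) := by
        rw [h2N]
        refine mul_le_mul_of_nonneg_left (mul_le_mul_of_nonneg_right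
          (mul_le_mul_of_nonneg_left hlogpow (by positivity)) hS0) (mul_nonneg hK (Real.rpow_nonneg hN0.le _))
    _ = K * (2 : ℝ) ^ a * (2 : ℝ) ^ C * Real.log N ^ C * ((N : ℝ) ^ (-τ) * (N : ℝ) ^ a) *
          ∑ q ∈ goodPrimes Δ' N, mainScaleReal Δ' q := by ring
    _ = K * (2 : ℝ) ^ a * (2 : ℝ) ^ C * Real.log N ^ C * (N : ℝ) ^ (-(τ - a)) *
          ∑ q ∈ goodPrimes Δ' N, mainScaleReal Δ' q := by rw [hexp]

/-! ### The window arithmetic of L7 (`δ = 3η`, `ε₀ = ε = η/16`) -/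

/-- **The saving exponent of L7 is positive**: `δ/2 − ((5/4)η + 2ε₀ + ε) = η/16` at `δ = 3η`, `ε₀ = ε = η/16`.
[cite: KowalskiMichelVanderKam2000, §6 p. 19 — derivation (window bookkeeping)] -/
theorem l7_saving_exponent (η : ℝ) :
    3 * η / 2 - (5 / 4 * η + 2 * (η / 16) + η / 16) = η / 16 := by ring

/-- **Room for the moduli**: `δ = 3η < 1/2 − η − 3ε` with `ε = η/16` for `0 < η < 1/10`. [folklore] -/
theorem l7_modulus_room {η : ℝ} (h0 : 0 < η) (h1 : η < 1 / 10) : 3 * η < 1 / 2 - η - 3 * (η / 16) := by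
  nlinarith

end Summit.Parity.GeneralizedHardyLittlewood.Theorems.BeyondDiagonalBeatsQuarter.OffDiag

end
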